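import Literature.MathematicalPhysics.QuantumFieldTheory.BalabanImbrieJaffe1984to88.BIJ88Eq5410Torus
import Literature.MathematicalPhysics.QuantumFieldTheory.BalabanImbrieJaffe1984to88.BIJ85Eq611Torus

/-!
# `BalabanImbrieJaffe1984to88.BIJ88Eq534Locality` — T. Bałaban, J. Imbrie, A. Jaffe, *Effective action and cluster properties of the abelian
Higgs model*, Commun. Math. Phys. **114** (1988) 257–315 [BalabanImbrieJaffe1988], Sect. 5.3 p. 280 [PDF 24]: the reduction
*"In Λ̄₂^{(k)*} this simplifies to u_k = (Q^{s*}_{k+1}[v]) exp ie_kη[Q^{s*}_kA′ − 𝒟_{k,loc}∂*Q^{e*}_k(∂A′ + L^{−2}Q^{e*}f)], (5.3.4)"* of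
(5.3.3) — the DISCHARGE, ON THE TORUS CARRIER OF RECORD (kind «model instance»), of the locality hypothesis `hT` under which this seat's
gens 6–8 stated (5.3.4), (5.4.2), (5.4.6), (5.4.8), (5.5.13), (5.5.14): for the ACTUAL exponent `g = 𝒟_{k,loc}∂*Q^{e*}_kf^{(k)}` of the
induction-hypothesis background field (4.2), `f^{(k)}(p) = (ie_k)^{−1} log u(p)` the plaquette field of the TRANSLATED configuration
`u = u′(Λ₁^{(k)*}Q^{s*}v)` ((5.3.1)), one has `g(b) = (𝒟_{k,loc}∂*Q^{e*}_k(∂A′ + L^{−2}Q^{e*}f))(b)` at every η-bond `b` at which the operator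
sees only the plaquettes of `Λ₁^{(k)**}` — by (5.3.2) (gen 5's `BIJ88Eq532Torus`) and the range of `𝒟_{k,loc}`.

statement-level skeleton of published theorems with citation tags; proofs where landed; nothing here is a claim about the Yang–Mills mass gap

PDF held: `paper:balaban1988-cmp114-bij-abelian-higgs-effective-action` (journal page = PDF page + 256); p. 280 [PDF 24] =
`HOME/lit-balaban-r16/renders/cmp114/original-p024-x2.png` (read as an image by this seat in gens 5–6), p. 281 [PDF 25] (gen 7), p. 261
[PDF 5] ((2.13): *"𝒟_{k,loc}(b₁,b₂) = 0 for dist(b₁,b₂) ≧ ½r(e_k)"*, `original-p005-x2.png`, read this session).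

CITATION HEADER (lean-in-tree rule).  Part of the lit-balaban TYPED SKELETON (HOME `run/shared/lean/pub/lit-balaban/`), PHASE-2 proof
seat p31 gen 8 (unit `lit-balaban-p31-g8`; second file of the gen after `BIJ88Eq5514Torus`; TAKING line HOME/STATUS.md 2026-08-21T18:56:03Z).
WHAT IS REPRODUCED: row `C2.Eq5.3.1-5.3.7` of `HOME/lit-balaban-r16/ROWS-C2-part2.md` (owner r16), the sentence *"In Λ̄₂^{(k)*} this
simplifies to (5.3.4)"* — gen 6's bridge `BIJ88Eq533Torus.eq534_of_eq533` and gen 7's (5.4.2) `BIJ88Eq542Torus.eq542_torus` carried the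
displayed content of that sentence as the hypothesis `hT : g(b) = (T(∂A′ + L^{−2}Q^{e*}f))(b)`; here `hT` is PROVED for `g = T f^{(k)}`
(`T = 𝒟_{k,loc}∂*Q^{e*}_k` a linear map of stated range, `f^{(k)}` the real plaquette field of the translated configuration).

THE PRINTED TEXT (verbatim, p. 280).  *"As in (3.24) we put u = u′(Λ₁^{(k)*}Q^{s*}v), (5.3.1) … we obtain that u′_b = e^{ie_kA′_b} with
|A′_b| ≦ cp(e_k), for b ∈ Λ₁^{(k)*}. Let us define f(p) = (ie_k)^{−1} log v(p). The restrictions on u(p) and the fact that v = Qu imply that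
|f(p)| ≦ cp(e_k) … Under the translation we have f^{(k)}(p) = Λ₁^{(k)**c}(ie_k)^{−1} log u′(p)v(p′₀) + Λ₁^{(k)**}(∂A′ + L^{−2}Q^{e*}f)(p),
(5.3.2) … After this translation the background gauge field is u_k = … (5.3.3) for b ∈ Λ̄₆^{(k−1)*}. … In Λ̄₂^{(k)*} this simplifies to
u_k = (Q^{s*}_{k+1}) exp ie_kη[Q^{s*}_kA′ − 𝒟_{k,loc}∂*Q^{e*}_k(∂A′ + L^{−2}Q^{e*}f)], (5.3.4) cf. (I.6.2.3)."*; (4.2) p. 274: *"u_k = (Q^{s*}_ku)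
exp(−ie_kη𝒟_{k,loc}∂*Q^{e*}_kf^{(k)}), (4.2) where f^{(k)}(p) = (ie_k)⁻¹ log u(p)"*.

WHAT IS PROVED, and what is data.  The translated configuration is gen 5/6's `u = surfMul u′ (cutoff (Λ₁′*) v)` with `u′ = e^{ie_kA′}` on
`Λ₁^{(k)*} = (blockUnion 1 X)*` (`X = Λ₁^{(k)′}` the block sites), its plaquette variables `GaugeField.plaqHol`, `(ie_k)^{−1} log` = r18's
`BIJ88Sect3Statements.fieldStrength e_k` (principal branch); `f(p′) = (1/e_k)·argB v(∂p′)` (gen 5); `Q^{e*}` = (2.22) — CONCRETE: p30's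
linear map `BIJ85Eq611Torus.qstarLin` (= gen 2's `BIJ85CurlQsstar.torusEdgeCells.Qstar`, `(Q^{e*}f)(p) = L²f(p′)` on `B^e(p′)`, `0`
elsewhere); `∂ = curl 1`; `L = P.L` (the model's block size).  DATA: the composite `T = 𝒟_{k,loc}∂*Q^{e*}_k` (a map from unit-lattice
plaquette functions to η-bond functions — only its RANGE at `b` enters, hypothesis `hdepT`: `(TF)(b)` depends only on `F` on `Λ₁^{(k)**}`;
metric form from gen 7's `BIJ88Eq5410Torus.starP_of_collar`), and the real plaquette field `F = f^{(k)}` through the hypothesis `hF :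
(F p : ℂ) = (ie_k)^{−1} log u(p)` on `Λ₁^{(k)**}` (the tree's `fieldStrength` is `ℂ`-valued; on the small-field plaquettes it is real,
`fieldStrength_transl_of_mem_starP`).  SMALLNESS (the principal branch): `|e_k((∂A′)(p) + L^{−2}(Q^{e*}f)(p))| < π` on `Λ₁^{(k)**}` —
hypothesis `hsmall`, DERIVED in `small_of_bounds` from the printed `|A′_b| ≦ a` on `Λ₁^{(k)*}`, `|f(p′)| ≦ a′` and `|e_k|(4a + a′) < π`
(p. 280: both `≦ cp(e_k)`; gen 5's `BIJ88Eq531SmallAPrime`/`BIJ88Eq531SmallF` prove those bounds on the torus).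
* §1 geometry: `starB_coarse_of_mem_edgeB` (an edge plaquette `p ∈ B^e(p′)` with its four corners in `Λ̄ = blockUnion 1 X` has the four
  block bonds of `∂p′` in `X*` — so the cut-off `Λ₁′*` is invisible in `v(p′₀)`), `plaqHol_surfMul_congr` (the plaquette variable of the
  translated field depends on `u′` only through the four bonds of `p`).
* §2 **`fieldStrength_transl_of_mem_starP`** ((5.3.2) on `Λ₁^{(k)**}` for the PARTIALLY specified `u′` of gens 6–8: `(ie_k)^{−1} log u(p) =
  (∂A′)(p) + L^{−2}(Q^{e*}f)(p)`, real), `re_fieldStrength_transl` (so `F := Re f^{(k)}` meets `hF`), `small_of_bounds`.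
* §3 **`locality534`** (THE DISCHARGE: `(TF)(b) = (T(∂A′ + L^{−2}Q^{e*}f))(b)` for every `T` seeing only `Λ₁^{(k)**}` at `b` and every real
  `F` with `hF`), `locality534_supDist` (the same for a `T` of `ℓ^∞` range `R` at a bond whose base point sits `R + 2` inside `Λ̄₁`).
* §4 **`eq534_torus`** ((5.3.4) ON THE TORUS with the ACTUAL exponent `g = Tf^{(k)}` of (4.2): on `b ∈ Λ̄₁^{(k)*}` with `hdepT`, `u_k(b) =
  (Q^{s*}_{k+1}v)(b) · exp ie_kη[(Q^{s*}_kA′)(b) − (T(∂A′ + L^{−2}Q^{e*}f))(b)]`, every operator concrete except `T`), **`eq542_torus_actual`**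
  (gen 7's (5.4.2) with `hT` discharged: the hypotheses left are `h`-free data, the two range statements `hdepT`/`hdep`, `hF`, `hsmall`).
HONEST SCOPE.  Not here: a torus construction of `𝒟_{k,loc}` ((2.12)) or of `∂*Q^{e*}_k` as ONE k-fold map (they stay the datum `T`; the
range *"𝒟_{k,loc}(b₁,b₂) = 0 for dist(b₁,b₂) ≧ ½r(e_k)"* (2.13) enters as `hdepT`), the bounds `|A′| ≦ cp(e_k)`, `|f| ≦ cp(e_k)` themselves
(gen 5), anything outside `Λ̄₁^{(k)*}` (there (5.3.3) keeps the `Λ₁^{(k)**c}` clause of (5.3.2), gen 5's `eq532_outside`).  Imports: gen 7's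
`BIJ88Eq5410Torus` (→ `BIJ88Eq542Torus` → gen 6's `BIJ88Eq564Torus`/`BIJ88Eq533Torus` → gen 5's `BIJ88Eq532Torus`) and p30 gen 5's
`BIJ85Eq611Torus` (only `qstarLin`).  Unit `lit-balaban-p31` (literature-prover-lit-balaban-p31-g8-0), 2026-08-21.
-/

namespace Literature.MathematicalPhysics.QuantumFieldTheory.BalabanImbrieJaffe1984to88.BIJ88Eq534Locality

open Literature.MathematicalPhysics.QuantumFieldTheory.Balaban1983to89
open BIJ88Sect3Statements (U1 toC toC_mul toC_one starB mem_starB starP fieldStrength)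
open BIJ88Sect4Statements (backgroundU)
open BIJ88Sect5StatementsPart3 (bgExp)
open BIJ85Sect1Model (argB argB_mem_Ico)
open BIJ85BlockAveragesTorus (expU1 surfMul surfFactor)
open BIJ85Eq453GaugeField (qsstarGIter)
open BIJ85Eq224Proof (torusBlockBondsIter)
open BIJ85CurlQsstar (torusEdgeCells mem_edgeB_iff blockOf_corner)
open BIJ85Eq611Torus (qstarLin)
open BIJ88Eq536Linearization (phaseField cutoff)
open BIJ88Eq532Torus (eq532_inside_of_mem eq532_inside_of_not_mem)
open BIJ88Eq533Torus (blockUnion mem_blockUnion_one eq533_inside)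
open BIJ88Eq564Torus (plaqHol_eq_of_bonds)
open BIJ88Eq542Torus (bonds_mem_starB_of_mem_starP eq542_torus blockUnion_mono)
open BIJ88Eq5410Torus (starP_of_collar)
open GaugeField (plaqHol)
open LatticeFieldCalculus (curl supDist)
open scoped BigOperators Real
open Complex Finset

noncomputable section

variable {P : Params} {i n : ℕ}

/-! ## §1 Geometry: the cut-off `Λ₁^{(k)′*}` is invisible in `v(p′₀)` for the plaquettes of `Λ₁^{(k)**}` -/

/-- kernel: lattice steps commute, `x + e_μ + e_ν = x + e_ν + e_μ`. [folklore] -/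
private theorem shift_comm {m : ℕ} (x : Balaban1983to89.Site P m) (μ ν : Fin P.d) : (x.shift μ).shift ν = (x.shift ν).shift μ := by
  funext κ
  simp only [Balaban1983to89.Site.shift, Function.update_apply]
  split_ifs <;> subst_vars <;> simp_all

/-- **An edge plaquette of `Λ̄**` has its coarse plaquette in `X**`**: if `p ∈ B^e(p′)` ((2.21): the blocks of the corners of `p` are the
corners of `p′`, gen 2's `mem_edgeB_iff`/`blockOf_corner`) and the four corners of `p` lie in `Λ̄ = blockUnion 1 X` (their blocks in `X`), then
the four block bonds of `∂p′` lie in `X*` — the hypotheses `h1`–`h4` of gen 5's `eq532_inside_of_mem`/`plaqHol_cutoff_of_mem` (*"p′₀ is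
formed by replacing each bond in p₀ with the block bond b′ in Λ₁^{(k)′*}"*: inside `Λ₁**` no bond of `∂p′` is cut off; standing range,
`2 ≤ d`). [cite: BalabanImbrieJaffe1988, (5.3.2) p.280] -/
theorem starB_coarse_of_mem_edgeB (hn : n + 1 ≤ P.m + P.K) (hd : 2 ≤ P.d) (X : Finset (Balaban1983to89.Site P (n + 1)))
    {p : Balaban1983to89.Plaq P n} {p' : Balaban1983to89.Plaq P (n + 1)} (h : p ∈ (torusEdgeCells P n hd).B p')
    (hp : p ∈ starP (blockUnion 1 X)) :
    (⟨p'.src, p'.μ⟩ : PBond P (n + 1)) ∈ starB X ∧ (⟨p'.src.shift p'.μ, p'.ν⟩ : PBond P (n + 1)) ∈ starB X ∧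
      (⟨p'.src.shift p'.ν, p'.μ⟩ : PBond P (n + 1)) ∈ starB X ∧ (⟨p'.src, p'.ν⟩ : PBond P (n + 1)) ∈ starB X := by
  simp only [starP, Finset.mem_filter, Finset.mem_univ, true_and] at hp
  obtain ⟨hx, hxμ, hxν, hxμν⟩ := hp
  rw [mem_blockUnion_one] at hx hxμ hxν hxμν
  obtain ⟨-, -, e0, eμ, eν⟩ := (mem_edgeB_iff hd p' p).1 h
  have eμν := blockOf_corner hn hd h
  rw [e0] at hx
  rw [eμ] at hxμ
  rw [eν] at hxν
  rw [eμν] at hxμν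
  refine ⟨(mem_starB X _).2 ⟨hx, hxμ⟩, (mem_starB X _).2 ⟨hxμ, hxμν⟩, (mem_starB X _).2 ⟨hxν, ?_⟩, (mem_starB X _).2 ⟨hx, hxν⟩⟩
  show (p'.src.shift p'.ν).shift p'.μ ∈ X
  rw [← shift_comm]
  exact hxμν

/-- kernel: **the plaquette variable of the translated field `u = u′·(cut-off·Q^{s*}v)` depends on `u′` only through the four bonds of `p`**:
if `u′ = e^{ie_kA′}` on those bonds, `u(∂p)` is the plaquette variable of the fully specified translation of gen 5 (`phaseField`).
[cite: BalabanImbrieJaffe1988, (5.3.2) p.280] -/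
theorem plaqHol_surfMul_congr {ek : ℝ} {u' : GaugeField P n U1} {A' : PBond P n → ℝ} (w : GaugeField P (n + 1) U1)
    {p : Balaban1983to89.Plaq P n} (h1 : u' ⟨p.src, p.μ⟩ = expU1 (ek * A' ⟨p.src, p.μ⟩))
    (h2 : u' ⟨p.src.shift p.μ, p.ν⟩ = expU1 (ek * A' ⟨p.src.shift p.μ, p.ν⟩))
    (h3 : u' ⟨p.src.shift p.ν, p.μ⟩ = expU1 (ek * A' ⟨p.src.shift p.ν, p.μ⟩)) (h4 : u' ⟨p.src, p.ν⟩ = expU1 (ek * A' ⟨p.src, p.ν⟩)) :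
    plaqHol (surfMul u' w) p = plaqHol (surfMul (phaseField fun b => ek * A' b) w) p := by
  refine plaqHol_eq_of_bonds ?_ ?_ ?_ ?_
  · show u' _ * surfFactor w _ = phaseField _ _ * surfFactor w _
    rw [h1]; rfl
  · show u' _ * surfFactor w _ = phaseField _ _ * surfFactor w _
    rw [h2]; rfl
  · show u' _ * surfFactor w _ = phaseField _ _ * surfFactor w _
    rw [h3]; rfl
  · show u' _ * surfFactor w _ = phaseField _ _ * surfFactor w _
    rw [h4]; rfl

/-! ## §2 (5.3.2) on `Λ₁^{(k)**}` for the partially specified `u′`: the field strength of the translated configuration is real and small -/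

/-- **(5.3.2) on `Λ₁^{(k)**}`.**  p. 280 [PDF 24], verbatim: *"Under the translation we have f^{(k)}(p) = Λ₁^{(k)**c}(ie_k)^{−1} log u′(p)v(p′₀)
+ Λ₁^{(k)**}(∂A′ + L^{−2}Q^{e*}f)(p), (5.3.2)"* — HERE for the translated configuration of gens 6–8, `u = surfMul u′ (cutoff (X*) v)` with
`u′ = e^{ie_kA′}` on `Λ₁^{(k)*} = (blockUnion 1 X)*` only (hypothesis `hu`), at a plaquette `p ∈ Λ₁^{(k)**} = (blockUnion 1 X)**`, under the
principal-branch smallness `|e_k((∂A′)(p) + L^{−2}(Q^{e*}f)(p))| < π`: `(ie_k)^{−1} log u(p) = (∂A′)(p) + L^{−2}(Q^{e*}f)(p)` with the CONCRETE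
`Q^{e*}` (2.22) of the tori (`qstarLin`, p30; = gen 2's `torusEdgeCells.Qstar`), `f(p′) = (1/e_k)·argB v(∂p′)`, `L = P.L` — gen 5's two
cases `eq532_inside_of_mem`/`_of_not_mem` joined, the cut-off being invisible by `starB_coarse_of_mem_edgeB` (standing range, `2 ≤ d`,
`e_k ≠ 0`). [cite: BalabanImbrieJaffe1988, (5.3.2) p.280] -/
theorem fieldStrength_transl_of_mem_starP (hn : n + 1 ≤ P.m + P.K) (hd : 2 ≤ P.d) {ek : ℝ} (hek : ek ≠ 0)
    (X : Finset (Balaban1983to89.Site P (n + 1))) {u' : GaugeField P n U1} {A' : PBond P n → ℝ}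
    (hu : ∀ c ∈ starB (blockUnion 1 X), u' c = expU1 (ek * A' c)) (v : GaugeField P (n + 1) U1)
    {p : Balaban1983to89.Plaq P n} (hp : p ∈ starP (blockUnion 1 X))
    (hsmall : |ek * (curl 1 A' p + (P.L : ℝ)⁻¹ ^ 2 * qstarLin P hd n (fun q => argB (toC (plaqHol v q)) / ek) p)| < π) :
    fieldStrength ek (toC (plaqHol (surfMul u' (cutoff (starB X) v)) p)) =
      ((curl 1 A' p + (P.L : ℝ)⁻¹ ^ 2 * qstarLin P hd n (fun q => argB (toC (plaqHol v q)) / ek) p : ℝ) : ℂ) := by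
  -- `u′` matters only on the four bonds of `p`, all in `Λ₁*`
  obtain ⟨b1, b2, b3, b4⟩ := bonds_mem_starB_of_mem_starP (blockUnion 1 X) hp
  rw [plaqHol_surfMul_congr (cutoff (starB X) v) (hu _ b1) (hu _ b2) (hu _ b3) (hu _ b4)]
  have hL : (P.L : ℝ) ≠ 0 := Nat.cast_ne_zero.mpr P.L_pos.ne'
  have hzpow : (P.L : ℝ) ^ (-(2 : ℤ)) = (P.L : ℝ)⁻¹ ^ 2 := by
    rw [zpow_neg, zpow_ofNat, inv_pow]
  have hQ : ∀ g : Balaban1983to89.Plaq P (n + 1) → ℝ, qstarLin P hd n g = (torusEdgeCells P n hd).Qstar g := fun _ => rfl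
  rw [hQ] at hsmall ⊢
  by_cases he : ∃ p', p ∈ (torusEdgeCells P n hd).B p'
  · -- edge plaquette: the coarse plaquette `p′` lies in `X**`, so the cut-off is invisible
    obtain ⟨p', hpp'⟩ := he
    obtain ⟨h1, h2, h3, h4⟩ := starB_coarse_of_mem_edgeB hn hd X hpp' hp
    have hQp : (torusEdgeCells P n hd).Qstar (fun q => argB (toC (plaqHol v q)) / ek) p =
        (P.L : ℝ) ^ 2 * (argB (toC (plaqHol v p')) / ek) := (torusEdgeCells P n hd).Qstar_of_mem _ hpp'
    have hsmall' : |ek * (curl 1 A' p + argB (toC (plaqHol v p')) / ek)| < π := by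
      have e : (P.L : ℝ)⁻¹ ^ 2 * ((P.L : ℝ) ^ 2 * (argB (toC (plaqHol v p')) / ek)) = argB (toC (plaqHol v p')) / ek := by
        rw [← mul_assoc, inv_pow, inv_mul_cancel₀ (pow_ne_zero 2 hL), one_mul]
      rwa [hQp, e] at hsmall
    rw [eq532_inside_of_mem hn hd hek A' v hpp' h1 h2 h3 h4 hsmall', hzpow]
  · -- no edge plaquette: `Q^{e*}f = 0` at `p`
    have he' : ∀ p', p ∉ (torusEdgeCells P n hd).B p' := fun p' h => he ⟨p', h⟩
    have hQp : (torusEdgeCells P n hd).Qstar (fun q => argB (toC (plaqHol v q)) / ek) p = 0 :=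
      (torusEdgeCells P n hd).Qstar_of_not_mem _ he'
    have hsmall' : |ek * curl 1 A' p| < π := by rwa [hQp, mul_zero, add_zero] at hsmall
    rw [eq532_inside_of_not_mem hn hd hek A' (starB X) v he' hsmall', hzpow]

/-- kernel: **the hypothesis `hF` is met by the real part** — on `Λ₁^{(k)**}`, under the principal-branch smallness, `(ie_k)^{−1} log u(p)`
is real, so `F := Re f^{(k)}` satisfies `(F p : ℂ) = (ie_k)^{−1} log u(p)` there (standing range, `2 ≤ d`, `e_k ≠ 0`).
[cite: BalabanImbrieJaffe1988, (5.3.2) p.280] -/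
theorem re_fieldStrength_transl (hn : n + 1 ≤ P.m + P.K) (hd : 2 ≤ P.d) {ek : ℝ} (hek : ek ≠ 0)
    (X : Finset (Balaban1983to89.Site P (n + 1))) {u' : GaugeField P n U1} {A' : PBond P n → ℝ}
    (hu : ∀ c ∈ starB (blockUnion 1 X), u' c = expU1 (ek * A' c)) (v : GaugeField P (n + 1) U1)
    {p : Balaban1983to89.Plaq P n} (hp : p ∈ starP (blockUnion 1 X))
    (hsmall : |ek * (curl 1 A' p + (P.L : ℝ)⁻¹ ^ 2 * qstarLin P hd n (fun q => argB (toC (plaqHol v q)) / ek) p)| < π) :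
    (((fieldStrength ek (toC (plaqHol (surfMul u' (cutoff (starB X) v)) p))).re : ℝ) : ℂ) =
      fieldStrength ek (toC (plaqHol (surfMul u' (cutoff (starB X) v)) p)) := by
  rw [fieldStrength_transl_of_mem_starP hn hd hek X hu v hp hsmall, Complex.ofReal_re]

/-- kernel: the RANGE of the unit-lattice curl in absolute value — `|(∂A′)(p)| ≤ 4a` when `|A′| ≤ a` on the four bonds of `p`.
[cite: BalabanImbrieJaffe1988, (5.3.1) p.280] -/
private theorem abs_curl_le {A' : PBond P n → ℝ} {a : ℝ} {p : Balaban1983to89.Plaq P n}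
    (h1 : |A' ⟨p.src, p.μ⟩| ≤ a) (h2 : |A' ⟨p.src.shift p.μ, p.ν⟩| ≤ a) (h3 : |A' ⟨p.src.shift p.ν, p.μ⟩| ≤ a)
    (h4 : |A' ⟨p.src, p.ν⟩| ≤ a) : |curl 1 A' p| ≤ 4 * a := by
  simp only [curl, one_smul]
  obtain ⟨l1, u1⟩ := abs_le.1 h1
  obtain ⟨l2, u2⟩ := abs_le.1 h2
  obtain ⟨l3, u3⟩ := abs_le.1 h3
  obtain ⟨l4, u4⟩ := abs_le.1 h4
  exact abs_le.2 ⟨by linarith, by linarith⟩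

/-- **The principal branch from the printed bounds.**  p. 280: *"u′_b = e^{ie_kA′_b} with |A′_b| ≦ cp(e_k), for b ∈ Λ₁^{(k)*}. … |f(p)| ≦
cp(e_k)"* — if `|A′| ≤ a` on `Λ₁^{(k)*}`, `|f(p′)| ≤ a′` (`a′ ≥ 0`) on `X**`, and `|e_k|(4a + a′) < π`, then `|e_k((∂A′)(p) + L^{−2}(Q^{e*}f)(p))| < π` at
every `p ∈ Λ₁^{(k)**}` — the hypothesis `hsmall` of `fieldStrength_transl_of_mem_starP` (standing range, `2 ≤ d`).
[cite: BalabanImbrieJaffe1988, (5.3.2) p.280] -/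
theorem small_of_bounds (hn : n + 1 ≤ P.m + P.K) (hd : 2 ≤ P.d) (ek : ℝ) (X : Finset (Balaban1983to89.Site P (n + 1)))
    {A' : PBond P n → ℝ} {f : Balaban1983to89.Plaq P (n + 1) → ℝ} {a a' : ℝ} (hA : ∀ c ∈ starB (blockUnion 1 X), |A' c| ≤ a)
    (hf : ∀ p' ∈ starP X, |f p'| ≤ a') (ha' : 0 ≤ a') (hπ : |ek| * (4 * a + a') < π) {p : Balaban1983to89.Plaq P n}
    (hp : p ∈ starP (blockUnion 1 X)) : |ek * (curl 1 A' p + (P.L : ℝ)⁻¹ ^ 2 * qstarLin P hd n f p)| < π := by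
  obtain ⟨b1, b2, b3, b4⟩ := bonds_mem_starB_of_mem_starP (blockUnion 1 X) hp
  have hcurl : |curl 1 A' p| ≤ 4 * a := abs_curl_le (hA _ b1) (hA _ b2) (hA _ b3) (hA _ b4)
  have hL : (P.L : ℝ) ≠ 0 := Nat.cast_ne_zero.mpr P.L_pos.ne'
  have hQ : |(P.L : ℝ)⁻¹ ^ 2 * qstarLin P hd n f p| ≤ a' := by
    show |(P.L : ℝ)⁻¹ ^ 2 * (torusEdgeCells P n hd).Qstar f p| ≤ a'
    by_cases he : ∃ p', p ∈ (torusEdgeCells P n hd).B p'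
    · obtain ⟨p', hpp'⟩ := he
      obtain ⟨h1, h2, h3, h4⟩ := starB_coarse_of_mem_edgeB hn hd X hpp' hp
      have hp' : p' ∈ starP X := by
        simp only [starP, Finset.mem_filter, Finset.mem_univ, true_and]
        exact ⟨((mem_starB X _).1 h1).1, ((mem_starB X _).1 h1).2, ((mem_starB X _).1 h4).2, ((mem_starB X _).1 h2).2⟩
      rw [(torusEdgeCells P n hd).Qstar_of_mem _ hpp', ← mul_assoc]
      have e : (P.L : ℝ)⁻¹ ^ 2 * ((torusEdgeCells P n hd).L : ℝ) ^ (torusEdgeCells P n hd).m = 1 := by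
        show (P.L : ℝ)⁻¹ ^ 2 * (P.L : ℝ) ^ 2 = 1
        rw [inv_pow, inv_mul_cancel₀ (pow_ne_zero 2 hL)]
      rw [e, one_mul]
      exact hf p' hp'
    · have he' : ∀ p', p ∉ (torusEdgeCells P n hd).B p' := fun p' h => he ⟨p', h⟩
      rw [(torusEdgeCells P n hd).Qstar_of_not_mem _ he', mul_zero, abs_zero]
      exact ha'
  calc |ek * (curl 1 A' p + (P.L : ℝ)⁻¹ ^ 2 * qstarLin P hd n f p)|
      = |ek| * |curl 1 A' p + (P.L : ℝ)⁻¹ ^ 2 * qstarLin P hd n f p| := abs_mul _ _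
    _ ≤ |ek| * (4 * a + a') := by
        refine mul_le_mul_of_nonneg_left ((abs_add_le _ _).trans (add_le_add hcurl hQ)) (abs_nonneg _)
    _ < π := hπ

/-! ## §3 The (5.3.4) locality DISCHARGED -/

/-- **"In Λ̄₂^{(k)*} this simplifies to (5.3.4)" — the locality of `𝒟_{k,loc}∂*Q^{e*}_k` DISCHARGED.**  For the ACTUAL exponent of (4.2), `g =
Tf^{(k)}` with `T = 𝒟_{k,loc}∂*Q^{e*}_k` any map whose value at the η-bond `b` depends only on the plaquette function on `Λ₁^{(k)**}` (hypothesis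
`hdepT`; (2.13) p. 261: *"𝒟_{k,loc}(b₁,b₂) = 0 for dist(b₁,b₂) ≧ ½r(e_k)"* plus the position of `b` deep inside `Λ̄₁`) and `F = f^{(k)}` the
real plaquette field of the translated configuration on `Λ₁^{(k)**}` (hypothesis `hF`), under the principal-branch smallness `hsmall`:
`(TF)(b) = (T(∂A′ + L^{−2}Q^{e*}f))(b)` — the hypothesis `hT` of gen 6's `BIJ88Eq533Torus.eq534_of_eq533`, gen 7's `BIJ88Eq542Torus.eq542_torus`
∕`eq546_torus`, gen 8's `BIJ88Eq5514Torus.eq5513_torus`∕`eq5514_torus` (with `T = 𝒟_{k,loc} ∘ S` there), for the concrete `Q^{e*}`, `L = P.L`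
(standing range, `2 ≤ d`, `e_k ≠ 0`). [cite: BalabanImbrieJaffe1988, (5.3.4) p.280] -/
theorem locality534 (hn : n + 1 ≤ P.m + P.K) (hd : 2 ≤ P.d) {ek : ℝ} (hek : ek ≠ 0)
    (X : Finset (Balaban1983to89.Site P (n + 1))) {u' : GaugeField P n U1} {A' : PBond P n → ℝ}
    (hu : ∀ c ∈ starB (blockUnion 1 X), u' c = expU1 (ek * A' c)) (v : GaugeField P (n + 1) U1)
    {β α : Type*} (T : (Balaban1983to89.Plaq P n → ℝ) → β → α) {b : β}
    (hdepT : ∀ F₁ F₂ : Balaban1983to89.Plaq P n → ℝ, (∀ p ∈ starP (blockUnion 1 X), F₁ p = F₂ p) → T F₁ b = T F₂ b)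
    (F : Balaban1983to89.Plaq P n → ℝ)
    (hF : ∀ p ∈ starP (blockUnion 1 X), (F p : ℂ) = fieldStrength ek (toC (plaqHol (surfMul u' (cutoff (starB X) v)) p)))
    (hsmall : ∀ p ∈ starP (blockUnion 1 X),
      |ek * (curl 1 A' p + (P.L : ℝ)⁻¹ ^ 2 * qstarLin P hd n (fun q => argB (toC (plaqHol v q)) / ek) p)| < π) :
    T F b = T (curl 1 A' + (P.L : ℝ)⁻¹ ^ 2 • qstarLin P hd n (fun q => argB (toC (plaqHol v q)) / ek)) b := by
  refine hdepT _ _ fun p hp => ?_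
  have h := hF p hp
  rw [fieldStrength_transl_of_mem_starP hn hd hek X hu v hp (hsmall p hp)] at h
  have h' := Complex.ofReal_injective h
  rw [h', Pi.add_apply, Pi.smul_apply, smul_eq_mul]

/-- **The same with the range in the torus `ℓ^∞` distance** (the form of (2.13)): if `(TF)(b)` depends only on the plaquettes `p` with
`|x_b − p₋|_∞ ≤ R` (`x_b` the unit-lattice point over the η-bond `b`), `Λ̄₁ = blockUnion 1 X` contains the cube of radius `N` about `x₀`,
`x_b` lies in the cube of radius `N₀`, and `N₀ + R + 2 ≤ N` (gen 7's `BIJ88Eq5410Torus.starP_of_collar`), then `(TF)(b) = (T(∂A′ +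
L^{−2}Q^{e*}f))(b)` (standing range, `2 ≤ d`, `e_k ≠ 0`). [cite: BalabanImbrieJaffe1988, (5.3.4) p.280] -/
theorem locality534_supDist (hn : n + 1 ≤ P.m + P.K) (hd : 2 ≤ P.d) {ek : ℝ} (hek : ek ≠ 0)
    (X : Finset (Balaban1983to89.Site P (n + 1))) {u' : GaugeField P n U1} {A' : PBond P n → ℝ}
    (hu : ∀ c ∈ starB (blockUnion 1 X), u' c = expU1 (ek * A' c)) (v : GaugeField P (n + 1) U1)
    {β α : Type*} (T : (Balaban1983to89.Plaq P n → ℝ) → β → α) (R : ℕ) (xb : β → Balaban1983to89.Site P n)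
    (hT : ∀ (F₁ F₂ : Balaban1983to89.Plaq P n → ℝ) (b : β), (∀ p, supDist (xb b) p.src ≤ R → F₁ p = F₂ p) → T F₁ b = T F₂ b)
    (x₀ : Balaban1983to89.Site P n) {N N₀ : ℕ} (hX : ∀ y, supDist x₀ y ≤ N → y ∈ blockUnion 1 X) (hN : N₀ + R + 2 ≤ N)
    {b : β} (hb : supDist x₀ (xb b) ≤ N₀) (F : Balaban1983to89.Plaq P n → ℝ)
    (hF : ∀ p ∈ starP (blockUnion 1 X), (F p : ℂ) = fieldStrength ek (toC (plaqHol (surfMul u' (cutoff (starB X) v)) p)))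
    (hsmall : ∀ p ∈ starP (blockUnion 1 X),
      |ek * (curl 1 A' p + (P.L : ℝ)⁻¹ ^ 2 * qstarLin P hd n (fun q => argB (toC (plaqHol v q)) / ek) p)| < π) :
    T F b = T (curl 1 A' + (P.L : ℝ)⁻¹ ^ 2 • qstarLin P hd n (fun q => argB (toC (plaqHol v q)) / ek)) b :=
  locality534 hn hd hek X hu v T
    (fun F₁ F₂ h => hT F₁ F₂ b fun p hp => h p (starP_of_collar (blockUnion 1 X) x₀ hX hN hb hp)) F hF hsmall

/-! ## §4 (5.3.4) and (5.4.2) on the torus with the ACTUAL exponent `g = 𝒟_{k,loc}∂*Q^{e*}_kf^{(k)}` of (4.2) -/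

/-- **(5.3.4) ON THE TORUS, unconditional on the locality.**  p. 280 [PDF 24], verbatim: *"In Λ̄₂^{(k)*} this simplifies to u_k = (Q^{s*}_{k+1})
exp ie_kη[Q^{s*}_kA′ − 𝒟_{k,loc}∂*Q^{e*}_k(∂A′ + L^{−2}Q^{e*}f)], (5.3.4)"*.  HERE: `u_k` = r18's (4.2) `backgroundU e_k η (Q^{s*}_ku) g` of the
translated configuration `u = u′(Λ₁′*Q^{s*}v)` with its ACTUAL exponent `g = Tf^{(k)}` (`T = 𝒟_{k,loc}∂*Q^{e*}_k` data with the range `hdepT`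
at `b`, `F = f^{(k)}` real with `hF`), `ηL^k = 1`; at an η-bond `b ∈ Λ̄₁^{(k)*}` (in print `Λ̄₂^{(k)*}`, two collars inside, which is what makes
`hdepT` hold): `u_k(b) = (Q^{s*}_{k+1}v)(b) · exp ie_kη[(Q^{s*}_kA′)(b) − (T(∂A′ + L^{−2}Q^{e*}f))(b)]` with the concrete `Q^{s*}_k`
(`torusBlockBondsIter … .Qsstar`), `Q^{s*}_{k+1}v = qsstarGIter (k+1) v`, `Q^{e*} = qstarLin`, `L = P.L`, `f(p′) = (1/e_k)argB v(∂p′)`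
(standing range, `2 ≤ d`, `e_k ≠ 0`). [cite: BalabanImbrieJaffe1988, (5.3.4) p.280] -/
theorem eq534_torus {k : ℕ} (hk : i + k + 1 ≤ P.m + P.K) (hd : 2 ≤ P.d) {ek η : ℝ} (hek : ek ≠ 0) (hη : η * (P.L : ℝ) ^ k = 1)
    (X : Finset (Balaban1983to89.Site P (i + k + 1))) {u' : GaugeField P (i + k) U1} {A' : PBond P (i + k) → ℝ}
    (hu : ∀ c ∈ starB (blockUnion 1 X), u' c = expU1 (ek * A' c)) (v : GaugeField P (i + k + 1) U1)
    (T : (Balaban1983to89.Plaq P (i + k) → ℝ) →ₗ[ℝ] (PBond P i → ℝ)) {b : PBond P i} (hb : b ∈ starB (blockUnion (k + 1) X))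
    (hdepT : ∀ F₁ F₂ : Balaban1983to89.Plaq P (i + k) → ℝ, (∀ p ∈ starP (blockUnion 1 X), F₁ p = F₂ p) → T F₁ b = T F₂ b)
    (F : Balaban1983to89.Plaq P (i + k) → ℝ)
    (hF : ∀ p ∈ starP (blockUnion 1 X), (F p : ℂ) = fieldStrength ek (toC (plaqHol (surfMul u' (cutoff (starB X) v)) p)))
    (hsmall : ∀ p ∈ starP (blockUnion 1 X),
      |ek * (curl 1 A' p + (P.L : ℝ)⁻¹ ^ 2 * qstarLin P hd (i + k) (fun q => argB (toC (plaqHol v q)) / ek) p)| < π) :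
    backgroundU ek η (fun b => toC (qsstarGIter k (surfMul u' (cutoff (starB X) v)) b)) (T F) b =
      toC (qsstarGIter (k + 1) v b) *
        Complex.exp (I * ((ek * η * ((torusBlockBondsIter P i k).Qsstar A' b -
          T (curl 1 A' + (P.L : ℝ)⁻¹ ^ 2 • qstarLin P hd (i + k) (fun q => argB (toC (plaqHol v q)) / ek)) b) : ℝ) : ℂ)) := by
  rw [eq533_inside hk hη X hu v (T F) hb, locality534 hk hd hek X hu v T hdepT F hF hsmall]

/-- **(5.4.2) ON THE TORUS with the ACTUAL exponent of (4.2)** — gen 7's `BIJ88Eq542Torus.eq542_torus` with its hypothesis `hT` DISCHARGED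
by `locality534`: p. 281 [PDF 25], *"u_k = (Q^{s*}_{k+1}v) exp ie_kη[(Q^{s*}_k − 𝒟_{k,loc}∂*Q^{e*}_k∂)□A′ − L^{−2}𝒟_{k,loc}∂*Q^{e*}_{k+1}f]_b,
(5.4.2)"* on `b ∈ □₀ ∩ Λ̄₁^{(k)*}` for `u_k = backgroundU e_k η (Q^{s*}_ku) (Tf^{(k)})`, the remaining hypotheses being the two range
statements (`hdepT`: `T` at `b` sees only `Λ₁**`; `hdep`: only `□**`), `hF`, `hsmall` (standing range, `2 ≤ d`, `e_k ≠ 0`).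
[cite: BalabanImbrieJaffe1988, (5.4.2) p.281] -/
theorem eq542_torus_actual {k : ℕ} (hk : i + k + 1 ≤ P.m + P.K) (hd : 2 ≤ P.d) {ek η : ℝ} (hek : ek ≠ 0) (hη : η * (P.L : ℝ) ^ k = 1)
    (X : Finset (Balaban1983to89.Site P (i + k + 1))) {u' : GaugeField P (i + k) U1} {A' : PBond P (i + k) → ℝ}
    (hu : ∀ c ∈ starB (blockUnion 1 X), u' c = expU1 (ek * A' c)) (v : GaugeField P (i + k + 1) U1)
    (T : (Balaban1983to89.Plaq P (i + k) → ℝ) →ₗ[ℝ] (PBond P i → ℝ))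
    (Xb X₀ : Finset (Balaban1983to89.Site P (i + k))) (hX₀ : X₀ ⊆ Xb)
    {b : PBond P i} (hb₁ : b ∈ starB (blockUnion (k + 1) X)) (hb₀ : b ∈ starB (blockUnion k X₀))
    (hdepT : ∀ F₁ F₂ : Balaban1983to89.Plaq P (i + k) → ℝ, (∀ p ∈ starP (blockUnion 1 X), F₁ p = F₂ p) → T F₁ b = T F₂ b)
    (hdep : ∀ F₁ F₂ : Balaban1983to89.Plaq P (i + k) → ℝ, (∀ p ∈ starP Xb, F₁ p = F₂ p) → T F₁ b = T F₂ b)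
    (F : Balaban1983to89.Plaq P (i + k) → ℝ)
    (hF : ∀ p ∈ starP (blockUnion 1 X), (F p : ℂ) = fieldStrength ek (toC (plaqHol (surfMul u' (cutoff (starB X) v)) p)))
    (hsmall : ∀ p ∈ starP (blockUnion 1 X),
      |ek * (curl 1 A' p + (P.L : ℝ)⁻¹ ^ 2 * qstarLin P hd (i + k) (fun q => argB (toC (plaqHol v q)) / ek) p)| < π) :
    backgroundU ek η (fun b => toC (qsstarGIter k (surfMul u' (cutoff (starB X) v)) b)) (T F) b =
      bgExp ek η (fun b => toC (qsstarGIter (k + 1) v b))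
        (fun b => (torusBlockBondsIter P i k).Qsstar ((↑(starB Xb) : Set (PBond P (i + k))).indicator A') b -
          T (curl 1 ((↑(starB Xb) : Set (PBond P (i + k))).indicator A')) b -
            (P.L : ℝ)⁻¹ ^ 2 * T (qstarLin P hd (i + k) (fun q => argB (toC (plaqHol v q)) / ek)) b) b :=
  eq542_torus hk hη X hu v (T F) (P.L : ℝ) T (qstarLin P hd (i + k)) (fun q => argB (toC (plaqHol v q)) / ek) Xb X₀ hX₀ hb₁ hb₀
    (locality534 hk hd hek X hu v T hdepT F hF hsmall) hdep

end

end Literature.MathematicalPhysics.QuantumFieldTheory.BalabanImbrieJaffe1984to88.BIJ88Eq534Locality
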